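import Literature.IUT.HodgeTheaters.Processions
import Literature.IUT.HodgeTheaters.BaseHodgeTheatersProofs3
import Literature.IUT.HodgeTheaters.BaseThetaDatumModel
import HarnessLib

/-!
# [IUTchI] Cor 4.12 (ii) — NON-VACUITY of the `𝒟`-ΘNF chain interface `DThetaNFChain` (row «NV-L5/DThetaNFChain»)

Mochizuki, *Inter-universal Teichmüller theory I*, kurims manuscript (May 2020), Cor 4.12 (ii) p. 121: "an
infinite chain `… ⟶^𝒟 ⁽ⁿ⁻¹⁾ℋ𝒯^{𝒟-ΘNF} ⟶^𝒟 ⁿℋ𝒯^{𝒟-ΘNF} ⟶^𝒟 …` of `𝒟`-ΘNF-linked `𝒟`-ΘNF-Hodge theaters".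
PROOF-ONLY companion (no `def`, no `instance`, no `structure`) of `Processions.lean` (abc-iut-L5-t3:
`BaseThetaDatum.DThetaNFChain 𝔡` = the one-field record `HT : ℤ → 𝔡.DThetaNFHodgeTheater`; the links are the
data-free full poly-isomorphisms `DThetaNFLink`). abc-iut-w5-d197's INHABITATION CENSUS L5 v1 (§A) lists
`DThetaNFChain` with ZERO producers; this file records, kernel-checked:

* `DThetaNFChain.nonempty_iff` — the EXACT criterion: `𝔡` carries a `𝒟`-ΘNF chain iff it has a
  `𝒟`-ΘNF-Hodge theater (unlike [IUTchIII] Prop 1.2 (x)'s `FrobeniusChain`, no distinctness is demanded by the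
  typed record, so a constant family suffices; `nonempty_of_injective` records the distinct-labels form too);
* `DThetaNFChain.nonempty` — GENUINE, UNCONDITIONAL: over EVERY `𝔡 : BaseThetaDatum` the chain interface is
  inhabited, through abc-iut-L5's landed producer `BaseThetaDatum.nonempty_dThetaNFHodgeTheater` (Def 4.6 (iii)
  non-vacuous: the model data of Examples 4.3 (iv), 4.4 (iv) form a `𝒟`-ΘNF-Hodge theater);
* `DThetaNFChain.core_instantiated` — hence Cor 4.12 (ii)'s landed `DThetaNFChain.core_spec` (nonempty links,
  closure under composition = the mono-analytic core) is instantiated over every `𝔡`;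
* `DThetaNFChain.nonempty_trivialModel` — on a closed term: at the tree's explicit TOY datum
  `BaseThetaDatum.trivialModel` (abc-iut-L5, `l = 5`, one place, one-object ambient categories).

HONEST LABEL: GENUINE relative to `𝔡` (the chain is built from the landed model Hodge theater of `𝔡`, constant in
`n` — print's `ⁿℋ𝒯` are "linked" copies, and the typed links carry no data); the closed-term instance sits over the
TOY datum `BaseThetaDatum.trivialModel` (degenerate by design). Nothing of
[IUTchI] is asserted; a witness is consistency evidence only. [claim: Mochizuki2012, status: disputed]
-/

namespace Literature.IUT.HodgeTheaters

namespace BaseThetaDatum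

universe u

variable {𝔡 : BaseThetaDatum.{u}}

namespace DThetaNFChain

/-- **IUTchI:Cor4.12(ii)** (kurims p.121) EXACT CRITERION: a base-Θ-datum carries a `𝒟`-ΘNF chain iff it has a
`𝒟`-ΘNF-Hodge theater (constant family `n ↦ H`; the typed record demands no distinctness).
[claim: Mochizuki2012, status: disputed] -/
theorem nonempty_iff : Nonempty (DThetaNFChain 𝔡) ↔ Nonempty 𝔡.DThetaNFHodgeTheater :=
  ⟨fun ⟨C⟩ => ⟨C.HT 0⟩, fun ⟨H⟩ => ⟨⟨fun _ => H⟩⟩⟩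

/-- **IUTchI:Cor4.12(ii)** (kurims p.121) The distinct-labels form: any `ℤ`-indexed family of `𝒟`-ΘNF-Hodge theaters
(injective or not) is a chain. [claim: Mochizuki2012, status: disputed] -/
theorem nonempty_of_family (H : ℤ → 𝔡.DThetaNFHodgeTheater) : Nonempty (DThetaNFChain 𝔡) := ⟨⟨H⟩⟩

variable (𝔡) in
/-- **IUTchI:Cor4.12(ii)** (kurims p.121) GENUINE, UNCONDITIONAL: over every `𝔡 : BaseThetaDatum` the `𝒟`-ΘNF chain
interface is inhabited — abc-iut-L5's `nonempty_dThetaNFHodgeTheater` (Def 4.6 (iii) non-vacuous: the model data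
`𝒟^⊚ ⟵ 𝒟_⋆ ⟶ 𝒟_>` of Examples 4.3 (iv), 4.4 (iv)) supplies the Hodge theater at every `n`.
[claim: Mochizuki2012, status: disputed] -/
theorem nonempty : Nonempty (DThetaNFChain 𝔡) :=
  nonempty_iff.2 (nonempty_dThetaNFHodgeTheater 𝔡)

variable (𝔡) in
/-- **IUTchI:Cor4.12(ii)** (kurims p.121) … hence Cor 4.12 (ii)'s mono-analytic core (landed `core_spec`: every link
`ⁿ𝒟_>^⊢ ⥲ ᵐ𝒟_>^⊢` nonempty, composites of links are links) is INSTANTIATED over every `𝔡`.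
[claim: Mochizuki2012, status: disputed] -/
theorem core_instantiated :
    ∃ C : DThetaNFChain 𝔡, ∀ n m : ℤ,
      (DThetaNFLink 𝔡 (C.HT n) (C.HT m)).Nonempty ∧
        ∀ e ∈ C.link n, ∀ e' ∈ DThetaNFLink 𝔡 (C.HT (n + 1)) (C.HT m),
          e ≪≫ e' ∈ DThetaNFLink 𝔡 (C.HT n) (C.HT m) :=
  ⟨(nonempty 𝔡).some, fun n m => (nonempty 𝔡).some.core_spec n m⟩

/-- **IUTchI:Cor4.12(ii)** (kurims p.121) On a CLOSED TERM (TOY label): the chain interface over the tree's explicit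
`BaseThetaDatum.trivialModel` (abc-iut-L5, `BaseThetaDatumModel.lean`: `l = 5`, a single bad place, one-object
ambient categories — a DEGENERATE-BY-DESIGN datum whose ≈ 40 axioms are kernel-checked) is inhabited — so
`DThetaNFChain` has a kernel inhabitant depending on no variable. [claim: Mochizuki2012, status: disputed] -/
theorem nonempty_trivialModel : Nonempty (DThetaNFChain BaseThetaDatum.trivialModel) :=
  nonempty BaseThetaDatum.trivialModel

end DThetaNFChain

end BaseThetaDatum

end Literature.IUT.HodgeTheaters
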